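import Mathlib

/-!
# Route PhotonSphereChannels — cutoff calculus for the energy-density approximation

Helper file (pure real analysis, Mathlib only) for the sub-goal `stub_exhaustionDensity` of stub
`stub_outgoingEnergyExhaustion` (H4) of line `isolated-kerr-connected-hull` (crux
stmt-FinalStateConjecture-14075): the density of compactly supported Cauchy data in the energy space of
`ψ_tt − ψ_xx + Vψ = 0` is proved by cutting the data off with `χ_R(x) = χ₀(x / R)`; this file supplies

* `RW.exists_scaledBump` — a fixed `C²` bump `χ₀` (`= 1` on `[-1, 1]`, `= 0` off `(-2, 2)`) and its
  scalings `χ_R`, with `|χ_R'| ≤ K / R` for ONE constant `K`;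
* `RW.cutoff_pointwise` — the pointwise algebra
  `(a g)² + (a f' − c f)² + v (a f)² ≤ 2 (g² + f'² + v f²) + 2 B f²` (`0 ≤ a ≤ 1`, `c² ≤ B`, `v ≥ 0`);
* `RW.lintegral_cutoff_le` — the cutoff error integral: the energy-type integral of the complementary
  data `((1 − χ) g, (1 − χ) f' − χ' f, (1 − χ) f)` is at most `2 ∫_{|x| > R} e + 2 (K/R)² · D · 4R`
  whenever `e = g² + f'² + v f²` and `f² ≤ D` on `|x| ≤ 2R`;
* the registered summary `stub_h4CutoffCalculus`.

No new definitions; standard material. [folklore]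
-/

namespace Summit.FinalStateConjecture.FinalStateConjecture.Theorems

-- every `Summit.FinalStateConjecture.FinalStateConjecture.…` name repeats the summit = sub-problem
-- segment (D-0017 layout), as in every landed `…Theorems` file of this route
set_option linter.dupNamespace false

open MeasureTheory Set Filter Topology Metric
open scoped ENNReal

noncomputable section

namespace RW

/-- **A fixed `C²` bump and its scalings.** There is `K ≥ 0` such that for every `R > 0` there is a
`C²` cutoff `χ` with derivative `c`, `0 ≤ χ ≤ 1`, `χ = 1` on `|x| ≤ R`, `χ = 0` on `|x| ≥ 2R`, `c = 0`
on `|x| > 2R` and `c² ≤ (K/R)²` (namely `χ(x) = χ₀(x/R)` for a fixed smooth bump `χ₀`). [folklore] -/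
theorem exists_scaledBump : ∃ K : ℝ, 0 ≤ K ∧ ∀ R : ℝ, 0 < R → ∃ χ c : ℝ → ℝ, ContDiff ℝ 2 χ ∧
    (∀ x, HasDerivAt χ (c x) x) ∧ (∀ x, 0 ≤ χ x ∧ χ x ≤ 1) ∧ (∀ x, |x| ≤ R → χ x = 1) ∧
    (∀ x, 2 * R ≤ |x| → χ x = 0) ∧ (∀ x, 2 * R < |x| → c x = 0) ∧ (∀ x, c x ^ 2 ≤ (K / R) ^ 2) := by
  let χ₀ : ContDiffBump (0 : ℝ) := ⟨1, 2, one_pos, one_lt_two⟩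
  have hχ₀c : ContDiff ℝ 2 χ₀ := χ₀.contDiff
  have hχ₀d : Differentiable ℝ χ₀ := hχ₀c.differentiable (by simp)
  obtain ⟨K, hK⟩ : ∃ K, ∀ y, ‖deriv χ₀ y‖ ≤ K :=
    (hχ₀c.continuous_deriv (by norm_num)).bounded_above_of_compact_support
      χ₀.hasCompactSupport.deriv
  refine ⟨K, (norm_nonneg _).trans (hK 0), fun R hR ↦ ⟨fun x ↦ χ₀ (x / R),
    fun x ↦ deriv χ₀ (x / R) / R, hχ₀c.comp (contDiff_id.div_const R), fun x ↦ ?_,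
    fun x ↦ ⟨χ₀.nonneg, χ₀.le_one⟩, fun x hx ↦ ?_, fun x hx ↦ ?_, fun x hx ↦ ?_, fun x ↦ ?_⟩⟩
  · have h := (hχ₀d (x / R)).hasDerivAt.comp x ((hasDerivAt_id x).div_const R)
    have h' : deriv χ₀ (x / R) * (1 / R) = deriv χ₀ (x / R) / R := by ring
    rw [h'] at h
    exact h
  · have hy : dist (x / R) 0 ≤ 1 := by
      rw [Real.dist_eq, sub_zero, abs_div, abs_of_pos hR, div_le_one hR]
      exact hx
    exact χ₀.one_of_mem_closedBall hy
  · have hy : 2 ≤ dist (x / R) 0 := by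
      rw [Real.dist_eq, sub_zero, abs_div, abs_of_pos hR, le_div_iff₀ hR]
      exact hx
    exact χ₀.zero_of_le_dist hy
  · have hy : 2 < dist (x / R) 0 := by
      rw [Real.dist_eq, sub_zero, abs_div, abs_of_pos hR, lt_div_iff₀ hR]
      exact hx
    have hnot : x / R ∉ tsupport (χ₀ : ℝ → ℝ) := by
      rw [χ₀.tsupport_eq]
      exact fun h ↦ (not_le.2 hy) (mem_closedBall.1 h)
    have h0 : deriv χ₀ (x / R) = 0 := by
      by_contra h
      exact hnot (support_deriv_subset (Function.mem_support.2 h))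
    show deriv χ₀ (x / R) / R = 0
    rw [h0, zero_div]
  · have h1 : |deriv χ₀ (x / R) / R| ≤ K / R := by
      rw [abs_div, abs_of_pos hR]
      exact div_le_div_of_nonneg_right ((Real.norm_eq_abs _).symm.le.trans (hK _)) hR.le
    show (deriv χ₀ (x / R) / R) ^ 2 ≤ (K / R) ^ 2
    calc (deriv χ₀ (x / R) / R) ^ 2 = |deriv χ₀ (x / R) / R| ^ 2 := (sq_abs _).symm
      _ ≤ (K / R) ^ 2 := pow_le_pow_left₀ (abs_nonneg _) h1 2

/-- Pointwise algebra of the cutoff error density: with `0 ≤ a ≤ 1`, `c² ≤ B`, `v ≥ 0`,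
`(a g)² + (a f' − c f)² + v (a f)² ≤ 2 (g² + f'² + v f²) + 2 B f²`. [folklore] -/
theorem cutoff_pointwise {a c g f' f v B : ℝ} (ha0 : 0 ≤ a) (ha1 : a ≤ 1) (hc : c ^ 2 ≤ B)
    (hv : 0 ≤ v) :
    (a * g) ^ 2 + (a * f' - c * f) ^ 2 + v * (a * f) ^ 2
      ≤ 2 * (g ^ 2 + f' ^ 2 + v * f ^ 2) + 2 * B * f ^ 2 := by
  have ha2 : a ^ 2 ≤ 1 := pow_le_one₀ ha0 ha1
  have t1 : (a * g) ^ 2 ≤ g ^ 2 := by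
    rw [mul_pow]
    exact mul_le_of_le_one_left (sq_nonneg _) ha2
  have t2 : (a * f' - c * f) ^ 2 ≤ 2 * f' ^ 2 + 2 * B * f ^ 2 := by
    have h1 : (a * f' - c * f) ^ 2 ≤ 2 * (a * f') ^ 2 + 2 * (c * f) ^ 2 := by
      nlinarith [sq_nonneg (a * f' + c * f)]
    have e1 : (a * f') ^ 2 ≤ f' ^ 2 := by
      rw [mul_pow]
      exact mul_le_of_le_one_left (sq_nonneg _) ha2
    have e2 : (c * f) ^ 2 ≤ B * f ^ 2 := by
      rw [mul_pow]
      exact mul_le_mul_of_nonneg_right hc (sq_nonneg _)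
    linarith
  have t3 : v * (a * f) ^ 2 ≤ v * f ^ 2 := by
    rw [mul_pow]
    exact mul_le_mul_of_nonneg_left (mul_le_of_le_one_left (sq_nonneg _) ha2) hv
  nlinarith [sq_nonneg g, sq_nonneg f', mul_nonneg hv (sq_nonneg f)]

/-- **The cutoff error integral.** For an energy-type density `e = g² + f'² + v f²` (`v ≥ 0`), a
cutoff `χ` as in `exists_scaledBump` (scale `R`, derivative `c`, `c² ≤ (K/R)²`) and a bound
`f² ≤ D` on `|x| ≤ 2R`, the energy-type integral of the complementary data
`((1 − χ) g, ((1 − χ) f)' = (1 − χ) f' − c f, (1 − χ) f)` is at most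
`2 ∫_{|x| > R} e + 2 (K/R)² · D · 4R`. [folklore] -/
theorem lintegral_cutoff_le {e f f' g v χ c : ℝ → ℝ} {K R D : ℝ} (hD : 0 ≤ D)
    (he : ∀ x, e x = g x ^ 2 + f' x ^ 2 + v x * f x ^ 2) (hv : ∀ x, 0 ≤ v x) (hem : Measurable e)
    (hχ01 : ∀ x, 0 ≤ χ x ∧ χ x ≤ 1) (hχ1 : ∀ x, |x| ≤ R → χ x = 1)
    (hc0 : ∀ x, 2 * R < |x| → c x = 0) (hc2 : ∀ x, c x ^ 2 ≤ (K / R) ^ 2)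
    (hfD : ∀ x, |x| ≤ 2 * R → f x ^ 2 ≤ D) :
    ∫⁻ x, ENNReal.ofReal (((1 - χ x) * g x) ^ 2 + ((1 - χ x) * f' x - c x * f x) ^ 2
        + v x * ((1 - χ x) * f x) ^ 2)
      ≤ 2 * (∫⁻ x in {x | R < |x|}, ENNReal.ofReal (e x))
        + ENNReal.ofReal (2 * (K / R) ^ 2 * (D * (2 * (2 * R)))) := by
  have hS₁m : MeasurableSet {x : ℝ | R < |x|} :=
    measurableSet_lt measurable_const continuous_abs.measurable
  have hS₂m : MeasurableSet (closedBall (0 : ℝ) (2 * R)) := measurableSet_closedBall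
  have hmemS₂ : ∀ x, x ∈ closedBall (0 : ℝ) (2 * R) ↔ |x| ≤ 2 * R := fun x ↦ by simp
  have he0 : ∀ x, 0 ≤ e x := fun x ↦ by
    rw [he]
    nlinarith [sq_nonneg (g x), sq_nonneg (f' x), mul_nonneg (hv x) (sq_nonneg (f x))]
  have htwo : ∀ x, ENNReal.ofReal (2 * e x) = 2 * ENNReal.ofReal (e x) := fun x ↦ by
    rw [ENNReal.ofReal_mul (by norm_num : (0 : ℝ) ≤ 2), ENNReal.ofReal_ofNat]
  -- pointwise domination by indicator functions
  have hdom : ∀ x, ENNReal.ofReal (((1 - χ x) * g x) ^ 2 + ((1 - χ x) * f' x - c x * f x) ^ 2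
      + v x * ((1 - χ x) * f x) ^ 2)
      ≤ {x | R < |x|}.indicator (fun y ↦ 2 * ENNReal.ofReal (e y)) x
        + (closedBall (0 : ℝ) (2 * R)).indicator
          (fun y ↦ ENNReal.ofReal (2 * (K / R) ^ 2) * ENNReal.ofReal (f y ^ 2)) x := by
    intro x
    have ha0 : 0 ≤ 1 - χ x := sub_nonneg.2 (hχ01 x).2
    have ha1 : 1 - χ x ≤ 1 := by linarith [(hχ01 x).1]
    by_cases h1 : x ∈ {x : ℝ | R < |x|}
    · by_cases h2 : x ∈ closedBall (0 : ℝ) (2 * R)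
      · have key := cutoff_pointwise (g := g x) (f' := f' x) (f := f x) ha0 ha1 (hc2 x) (hv x)
        rw [indicator_of_mem h1, indicator_of_mem h2, ← htwo, ← ENNReal.ofReal_mul (by positivity),
          ← ENNReal.ofReal_add (by nlinarith [he0 x]) (by positivity)]
        exact ENNReal.ofReal_le_ofReal (by rw [he] at *; linarith)
      · have hcx : c x = 0 := hc0 x (lt_of_not_ge fun h ↦ h2 ((hmemS₂ x).2 h))
        have hcx2 : c x ^ 2 ≤ 0 := by rw [hcx]; norm_num
        have key := cutoff_pointwise (g := g x) (f' := f' x) (f := f x) ha0 ha1 hcx2 (hv x)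
        rw [indicator_of_mem h1, indicator_of_notMem h2, add_zero, ← htwo]
        exact ENNReal.ofReal_le_ofReal (by rw [he]; linarith)
    · have ha : 1 - χ x = 0 := by
        rw [hχ1 x (le_of_not_gt h1), sub_self]
      by_cases h2 : x ∈ closedBall (0 : ℝ) (2 * R)
      · rw [indicator_of_notMem h1, indicator_of_mem h2, zero_add, ha,
          ← ENNReal.ofReal_mul (by positivity)]
        refine ENNReal.ofReal_le_ofReal ?_
        have hc := hc2 x
        nlinarith [sq_nonneg (f x), hv x]
      · have hcx : c x = 0 := hc0 x (lt_of_not_ge fun h ↦ h2 ((hmemS₂ x).2 h))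
        rw [indicator_of_notMem h1, indicator_of_notMem h2, add_zero, ha, hcx]
        simp
  have hmeasG₁ : Measurable ({x : ℝ | R < |x|}.indicator fun y ↦ 2 * ENNReal.ofReal (e y)) :=
    ((ENNReal.measurable_ofReal.comp hem).const_mul 2).indicator hS₁m
  have hball : ∫⁻ x in closedBall (0 : ℝ) (2 * R), ENNReal.ofReal (f x ^ 2)
      ≤ ENNReal.ofReal D * ENNReal.ofReal (2 * (2 * R)) := by
    rw [← Real.volume_closedBall (0 : ℝ) (2 * R), ← setLIntegral_const]
    exact setLIntegral_mono' hS₂m fun y hy ↦ ENNReal.ofReal_le_ofReal (hfD y ((hmemS₂ y).1 hy))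
  calc ∫⁻ x, ENNReal.ofReal (((1 - χ x) * g x) ^ 2 + ((1 - χ x) * f' x - c x * f x) ^ 2
        + v x * ((1 - χ x) * f x) ^ 2)
      ≤ ∫⁻ x, ({x | R < |x|}.indicator (fun y ↦ 2 * ENNReal.ofReal (e y)) x
        + (closedBall (0 : ℝ) (2 * R)).indicator
          (fun y ↦ ENNReal.ofReal (2 * (K / R) ^ 2) * ENNReal.ofReal (f y ^ 2)) x) :=
        lintegral_mono hdom
    _ = 2 * (∫⁻ x in {x | R < |x|}, ENNReal.ofReal (e x))
        + ENNReal.ofReal (2 * (K / R) ^ 2) * (∫⁻ x in closedBall (0 : ℝ) (2 * R),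
          ENNReal.ofReal (f x ^ 2)) := by
        rw [lintegral_add_left hmeasG₁, lintegral_indicator hS₁m, lintegral_indicator hS₂m,
          lintegral_const_mul' _ _ ENNReal.ofNat_ne_top,
          lintegral_const_mul' _ _ ENNReal.ofReal_ne_top]
    _ ≤ 2 * (∫⁻ x in {x | R < |x|}, ENNReal.ofReal (e x))
        + ENNReal.ofReal (2 * (K / R) ^ 2) * (ENNReal.ofReal D * ENNReal.ofReal (2 * (2 * R))) := by
        gcongr
    _ = _ := by
        rw [← ENNReal.ofReal_mul hD, ← ENNReal.ofReal_mul (by positivity)]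

/-- **Registered summary `stub_h4CutoffCalculus`** (sub-goal of `stub_exhaustionDensity`, crux
stmt-FinalStateConjecture-14075, line `isolated-kerr-connected-hull`): scaled `C²` cutoffs with a uniform
`K / R` derivative bound. [folklore] -/
theorem stub_h4CutoffCalculus :
    ∃ K : ℝ, 0 ≤ K ∧ ∀ R : ℝ, 0 < R → ∃ χ c : ℝ → ℝ, ContDiff ℝ 2 χ ∧
      (∀ x, HasDerivAt χ (c x) x) ∧ (∀ x, 0 ≤ χ x ∧ χ x ≤ 1) ∧ (∀ x, |x| ≤ R → χ x = 1) ∧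
      (∀ x, 2 * R ≤ |x| → χ x = 0) ∧ (∀ x, 2 * R < |x| → c x = 0) ∧
      (∀ x, c x ^ 2 ≤ (K / R) ^ 2) :=
  exists_scaledBump

end RW

end

end Summit.FinalStateConjecture.FinalStateConjecture.Theorems
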